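import Summits.QuantumFields.BalabanUV.Beta.WilsonStencilZ4

/-!
# `Beta.VecTableZ4` — the `ℤ⁴` vertex → table identification at one loop for the model vector ∕ ghost sector:
# `GradedBubbles.bub` of the LEAF 2 stencils `currentStn`, `spinStn`, `vecStn` through an even leg IS the cell table of
# `GhostTable` ∕ `SpinTable` ∕ `SquareTable`, and through the free legs IT IS `SquareTable.lattBubble univ (bfCoeff N) bfP bfQ`

HONEST FRAMING (cell `pub-balaban`, β sub-cell, analysis prover AN3, generation 16, second node «VEC-TABLE-Z4»; tree target
`Summits/QuantumFields/BalabanUV/Beta/`).  Discharging `BetaPertH` would make Bałaban's ultraviolet stability UNCONDITIONAL — a real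
constructive-QFT result; it is NOT the continuum limit and NOT the Clay problem.  This file is ELEMENTARY β-function BOOKKEEPING made
rigorous: it closes, with the kernel and on `ℤ⁴`, the dictionary item that the Literature leaves open in so many words —
`Beta.SpinTable` header (iv) «torus `Λ` ↔ `ℤ⁴`: §§2–4 hold on every finite abelian `Λ`; §5 is stated on `ℤ⁴` as an identity
of kernel FUNCTIONS» and `Beta.SquareTable` §5 ∕ `SpinTable.lattBubble_bf_eq_bfKernel` «which lattice vertex produces which coefficient …
NOT asserted» — for the MODEL vector∕ghost vertices: the `ℤ⁴` bubble (`GradedBubbles.bub`, the object of LEAF 2's log-free count) of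
the stencils `WilsonStencilZ4.currentStn ∕ spinStn ∕ vecStn` (whose realisations on every torus ARE `GhostTable.current (copies)`,
`SpinTable.spinVertex`, `SpinTable.vecVertex`, by `WilsonStencilZ4.real_*`) is computed in closed form, letter for letter the torus
tables, and at the free legs it is `SquareTable`'s realised background-field table BY NAME.  NOT summit progress.

ABSOLUTE RULE.  No internally-minted statement may enter as a cited fact.  Every hypothesis is either kernel-proved in this package
or a verbatim quotation of a PUBLISHED theorem with page reference.  The manuscript(s) under audit are NOT citable for their own
disputed steps — they are the thing under adjudication; programme-internal (2001/route/tribunal) claims are never citable.  In this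
file NOTHING is cited and nothing is assumed: every statement is an identity proved by unfolding + `ring`∕`abel` against the
UNMODIFIED definitions of `GradedBubbles` (`term`, `bub`, `rowDiff`, …), `WilsonStencilZ4`, `GhostTable` (`cellForm`, `mixedDiffFun`,
`copies`), `SpinTable` (`spinMat`, `bfKernel`), `SquareTable` (`lattBubble`, `bfCoeff`, `bfP`, `bfQ`), `ColourTrace` (`adMat`,
`Complete`, `TrOrthonormal`) and `TwoPowerLegs.free`, all imported BY NAME; the only hypotheses are evenness of the leg
(`f L k (−w) = f L k w`, PROVED for `free.g` from `latticeGreen_neg`), `μ ≠ ν`, and — in §4 only — the generator-family hypotheses of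
`GhostTable.trace_adMat_gen_sq` exactly as in `SpinTable.three_sectors_bf`.

WHAT IS PROVED ([folklore] throughout; `u_μ = unitVec μ`; second vertex at the cell corner `w = v + u_μ` as in
`GhostTable.bubble_current_cell`).
* §1 THE GHOST ∕ CURRENT TABLE.  `ghostStn μ m := rowDiff u_μ (pt m) ++ (−1)•colDiff u_μ (pt m)` over ANY internal index
  (`currentStn μ A = ghostStn μ (copies (Fin 4) A)`, `rfl`); for any two legs `bub f₁ f₂ (ghostStn μ m) (ghostStn ν m′) L k w` is
  `trace(m m′)` times the four-product bracket of `GhostTable.bubble_current` LETTER FOR LETTER (`bub_ghost_ghost`), and for one even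
  leg `= 2·trace(m m′)·cellForm (f L k) u_μ u_ν v` (`bub_ghost_ghost_cell`, via `GhostTable.bracket_eq_cellForm`).
* §2 THE SPIN TABLE.  `bub f₁ f₂ (spinTerm μ A β) (spinTerm ν A′ β′)` is `trace(spinMat β μ A · spinMat β′ ν A′)` times the
  bracket of `SpinTable.bubble_diag_pair` (`bub_spinTerm_spinTerm`); summing the sixteen with `SpinTable.trace_spinMat_mul_spinMat_offdiag` and
  `sum_sum_ite_pair`: for `μ ≠ ν` and an even leg **`bub f f (spinStn μ A) (spinStn ν A′) L k (v + u_μ) =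
  −(2·trace(AA′)·mixedDiffFun ((f L k)²) u_μ u_ν v)`** (`bub_spin_spin_cell`) — the exact `ℤ⁴` twin of `SpinTable.bubble_spin_cell`.
* §3 NO CROSS TABLE (`bub_current_spin = 0 = bub_spin_current`, any legs: every term carries `trace(copies · spinMat) = 0`) and
  **THE VECTOR TABLE**
  `bub f f (vecStn s μ A) (vecStn s ν A′) L k (v + u_μ) = 2·(4·trace(AA′))·cellForm − s²·(2·trace(AA′)·D(f²))`
  (`bub_vec_vec_cell`) — the exact `ℤ⁴` twin of `SpinTable.bubble_vec_cell` at `card D = 4`; it depends on `s` through `s²` only, so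
  the Wilson action's DERIVED coupling `sTot = −2` (`PlaquetteWeitzenbock`) and `SpinTable`'s labelled `s = 2` give the same table
  (`bub_vec_vec_sTot`).
* §4 THREE SECTORS.  `½·bub(vecStn s) − bub(ghostStn) = trace(AA′)·(2·cellForm − s²·D(f²))` (`three_sectors_Z4`); with the real
  adjoint matrices of a complete tr-orthonormal Hermitian generator family and `N ≠ 0` it is `bfKernel (f L k) N u_μ u_ν v` at `s² = 4`
  (`three_sectors_bf_Z4`), and AT THE FREE LEGS `free.g` (`= gFree`):
  **`½·bub free.g free.g (vecStn 2 μ (ad τ_a)) (vecStn 2 ν (ad τ_a)) L k (v + u_μ)`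
  `− bub free.g free.g (ghostStn μ (ad τ_a)) (ghostStn ν (ad τ_a)) L k (v + u_μ)`
  `= SquareTable.lattBubble univ (bfCoeff N) (bfP hμν) (bfQ hμν) L k v`** (`model_table_free_eq_lattBubble_bf`, also at `s = sTot`):
  GradedBubbles' `ℤ⁴` table of the LEAF 2 model stencils through the free legs IS the realised background-field table of
  `SquareTable` §3 — the table whose continuum counterpart is `SquareTable.hval_bf` (`leadingIntegrand (kappaBal N)`).
* §5 WHERE THIS SITS IN THE WILSON VERTEX.  By bilinearity `bub (mainStn γ A) (mainStn γ′ A′) = bub(vecStn sTot, vecStn sTot) +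
  2•bub(vecStn, divStn) + 2•bub(divStn, vecStn) + 4•bub(divStn, divStn)` (`bub_main_main_split`): the first block is §3–§4; the three
  longitudinal blocks are NOT evaluated here (DIV-FATE, an3 HANDOFF) and NOT CLAIMED.

NOT PROVED HERE, NOT CLAIMED: the longitudinal (`divStn`) blocks, any volume or continuum limit, the lattice-sum value (F1)–(F3), the
diagonal `μ = ν` tables, anything about Bałaban's propagators, `BetaPertH`, or the Clay problem.
(buildfix 2026-08-20: comment-only re-land to re-enqueue the module build after its blocking imports were repaired; no declaration changed.)
-/

namespace Summit.QuantumFields.BalabanUV.Beta.VecTableZ4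

open Finset
open scoped BigOperators
open Literature.Probability.LatticeModels (latticeGreen latticeGreen_neg)
open Literature.MathematicalPhysics.QuantumFieldTheory.Balaban1983to89.Beta
open Literature.MathematicalPhysics.QuantumFieldTheory.Balaban1983to89.Beta.DyadicShell (Pt)
open Literature.MathematicalPhysics.QuantumFieldTheory.Balaban1983to89.Beta.BubbleTransfer (unitVec lattBubble)
open Literature.MathematicalPhysics.QuantumFieldTheory.Balaban1983to89.Beta.TwoPowerLegs (free)
open Literature.MathematicalPhysics.QuantumFieldTheory.Balaban1983to89.Beta.GhostTable (copies current cellForm mixedDiffFun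
  fwdDiffFun gFree free_g_eq bracket_eq_cellForm trace_copies_mul trace_adMat_gen_sq)
open Literature.MathematicalPhysics.QuantumFieldTheory.Balaban1983to89.Beta.ColourTrace (adMat Complete TrOrthonormal)
open Literature.MathematicalPhysics.QuantumFieldTheory.Balaban1983to89.Beta.SquareTable (bfCoeff bfP bfQ)
open Literature.MathematicalPhysics.QuantumFieldTheory.Balaban1983to89.Beta.SpinTable (spinMat spinVertex vecVertex bfKernel
  bfKernel_eq_model trace_spinMat_mul_spinMat_offdiag trace_spinMat_mul_copies trace_copies_mul_spinMat sum_sum_ite_pair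
  lattBubble_bf_eq_bfKernel)
open Literature.MathematicalPhysics.QuantumFieldTheory.Balaban1983to89.Beta.PlaquetteWeitzenbock (sTot)
open Literature.MathematicalPhysics.QuantumFieldTheory.Balaban1983to89.Beta.GradedBubbles
open Summit.QuantumFields.BalabanUV.Beta.GradedStencilDictionary
open Summit.QuantumFields.BalabanUV.Beta.WilsonStencilZ4

/-! ## §1 The ghost ∕ current table on `ℤ⁴` -/

section Ghost

variable {I : Type*} [Fintype I]

/-- THE COLOUR CURRENT AS A `ℤ⁴` STENCIL over any internal index: `(ρ_{u_μ} − 1)(pt m) ++ (−1)•(σ_{u_μ} − 1)(pt m)` (realised: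
`GhostTable.current z (e μ) m`, cf. `WilsonStencilZ4.real_currentStn`).  A definition asserting nothing. [folklore] -/
def ghostStn (μ : Fin 4) (m : Matrix I I ℝ) : Stn I :=
  rowDiff (unitVec μ) (pt m) ++ smulS (-1) (colDiff (unitVec μ) (pt m))

/-- `WilsonStencilZ4.currentStn` is the ghost stencil of the copies, by `rfl`. [folklore] -/
theorem currentStn_eq_ghostStn {C : Type*} (μ : Fin 4) (A : Matrix C C ℝ) :
    currentStn μ A = ghostStn μ (copies (Fin 4) A) := rfl

omit [Fintype I] in
/-- the ghost stencil is a once-differenced stencil. [folklore] -/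
theorem graded_ghostStn (μ : Fin 4) (m : Matrix I I ℝ) : Graded 1 (ghostStn μ m) :=
  Graded.append (Graded.rowDiff (isStep_unitVec μ) (Graded.zero _))
    (Graded.smul _ (Graded.colDiff (isStep_unitVec μ) (Graded.zero _)))

/-- unfolding of one elementary bubble term. [folklore] -/
theorem term_mk (f₁ f₂ : Fam) (x y x' y' : Pt) (m m' : Matrix I I ℝ) (L k : ℕ) (w : Pt) :
    term f₁ f₂ ⟨x, y, m⟩ ⟨x', y', m'⟩ L k w = Matrix.trace (m * m') * (f₁ L k (x - y' - w) * f₂ L k (w + (x' - y))) := rfl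

/-- **THE GHOST BUBBLE ON `ℤ⁴`, ANY TWO LEGS**: `trace(m m′)` times the four-product bracket of `GhostTable.bubble_current`, letter
for letter (`e ↦ u_μ`, `e′ ↦ u_ν`, `g·g ↦ f₁·f₂`). [folklore] -/
theorem bub_ghost_ghost (f₁ f₂ : Fam) (μ ν : Fin 4) (m m' : Matrix I I ℝ) (L k : ℕ) (w : Pt) :
    bub f₁ f₂ (ghostStn μ m) (ghostStn ν m') L k w =
      Matrix.trace (m * m') *
        (f₁ L k (unitVec μ - w) * f₂ L k (w + unitVec ν) - f₁ L k (unitVec μ - unitVec ν - w) * f₂ L k w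
          - f₁ L k (-w) * f₂ L k (w + unitVec ν - unitVec μ) + f₁ L k (-unitVec ν - w) * f₂ L k (w - unitVec μ)) := by
  simp only [ghostStn, rowDiff, colDiff, rowSh, colSh, smulS, pt, List.map_cons, List.map_nil, List.cons_append, List.nil_append,
    bub, bubRow, Pi.add_apply, term_mk, Matrix.smul_mul, Matrix.mul_smul, Matrix.trace_smul, smul_eq_mul, add_zero, zero_add,
    sub_zero, zero_sub, ← add_sub_assoc, ← sub_eq_add_neg]
  ring

/-- **THE GHOST TABLE IN CELL FORM ON `ℤ⁴`** (one even leg, second vertex at the corner `v + u_μ`):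
`2·trace(m m′)·cellForm (f L k) u_μ u_ν v` — the exact `ℤ⁴` twin of `GhostTable.bubble_current_cell`. [folklore] -/
theorem bub_ghost_ghost_cell {f : Fam} (hf : ∀ L k w, f L k (-w) = f L k w) (μ ν : Fin 4) (m m' : Matrix I I ℝ) (L k : ℕ)
    (v : Pt) :
    bub f f (ghostStn μ m) (ghostStn ν m') L k (v + unitVec μ) =
      2 * Matrix.trace (m * m') * cellForm (f L k) (unitVec μ) (unitVec ν) v := by
  rw [bub_ghost_ghost, ← bracket_eq_cellForm]
  have h1 : f L k (unitVec μ - (v + unitVec μ)) = f L k (v + unitVec μ - unitVec μ) := by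
    rw [← hf L k (v + unitVec μ - unitVec μ), neg_sub]
  have h2 : f L k (unitVec μ - unitVec ν - (v + unitVec μ)) = f L k (v + unitVec μ + unitVec ν - unitVec μ) := by
    rw [← hf L k (v + unitVec μ + unitVec ν - unitVec μ)]; congr 1; abel
  have h3 : f L k (-unitVec ν - (v + unitVec μ)) = f L k (v + unitVec μ + unitVec ν) := by
    rw [← hf L k (v + unitVec μ + unitVec ν)]; congr 1; abel
  rw [h1, h2, h3, hf]
  ring

/-- with the copies: `2·(4·trace(AA′))·cellForm` — the twin of `GhostTable.bubble_current_copies_cell` at `card D = 4`. [folklore] -/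
theorem bub_current_current_cell {C : Type*} [Fintype C] {f : Fam} (hf : ∀ L k w, f L k (-w) = f L k w) (μ ν : Fin 4)
    (A A' : Matrix C C ℝ) (L k : ℕ) (v : Pt) :
    bub f f (currentStn μ A) (currentStn ν A') L k (v + unitVec μ) =
      2 * (4 * Matrix.trace (A * A')) * cellForm (f L k) (unitVec μ) (unitVec ν) v := by
  rw [currentStn_eq_ghostStn, currentStn_eq_ghostStn, bub_ghost_ghost_cell hf, trace_copies_mul, Fintype.card_fin, Nat.cast_ofNat]

end Ghost

/-! ## §2 The spin table on `ℤ⁴` -/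

section Spin

variable {C : Type*} [Fintype C]

/-- **ONE SPIN TERM AGAINST ANOTHER, ANY TWO LEGS**: `trace(spinMat β μ A · spinMat β′ ν A′)` times the bracket of
`SpinTable.bubble_diag_pair` at the sites `x = −u_β, y = 0` (first vertex) and `x′ = w − u_β′, y′ = w` (second). [folklore] -/
theorem bub_spinTerm_spinTerm (f₁ f₂ : Fam) (μ ν β β' : Fin 4) (A A' : Matrix C C ℝ) (L k : ℕ) (w : Pt) :
    bub f₁ f₂ (spinTerm μ A β) (spinTerm ν A' β') L k w =
      Matrix.trace (spinMat β μ A * spinMat β' ν A') *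
        (f₁ L k (-unitVec β + unitVec β' - w) * f₂ L k (w - unitVec β' + unitVec β)
          - f₁ L k (-unitVec β - w) * f₂ L k (w + unitVec β) - f₁ L k (unitVec β' - w) * f₂ L k (w - unitVec β')
          + f₁ L k (-w) * f₂ L k w) := by
  simp only [spinTerm, jointDiff, rowDiff, colDiff, rowSh, colSh, smulS, pt, List.map_cons, List.map_nil, List.cons_append,
    List.nil_append, bub, bubRow, Pi.add_apply, term_mk, Matrix.smul_mul, Matrix.mul_smul, Matrix.trace_smul, smul_eq_mul, add_zero,
    sub_zero, zero_sub, sub_neg_eq_add, ← sub_eq_add_neg]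
  ring

/-- the spin stencil's bubble is the direction sum of its terms' bubbles (first slot). [folklore] -/
theorem bub_spinStn_left (f₁ f₂ : Fam) (μ : Fin 4) (A : Matrix C C ℝ) (W : Stn (C × Fin 4)) (L k : ℕ) (w : Pt) :
    bub f₁ f₂ (spinStn μ A) W L k w = ∑ β : Fin 4, bub f₁ f₂ (spinTerm μ A β) W L k w := by
  simp only [spinStn, bub_append_left, Pi.add_apply, Fin.sum_univ_four]

/-- (second slot). [folklore] -/
theorem bub_spinStn_right (f₁ f₂ : Fam) (ν : Fin 4) (A' : Matrix C C ℝ) (V : Stn (C × Fin 4)) (L k : ℕ) (w : Pt) :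
    bub f₁ f₂ V (spinStn ν A') L k w = ∑ β' : Fin 4, bub f₁ f₂ V (spinTerm ν A' β') L k w := by
  simp only [spinStn, bub_append_right, Pi.add_apply, Fin.sum_univ_four]

/-- **THE SPIN TABLE ON `ℤ⁴`**: for an even leg and `μ ≠ ν`, `bub f f (spinStn μ A) (spinStn ν A′) L k (v + u_μ) =
−2·trace(AA′)·mixedDiffFun ((f L k)²) u_μ u_ν v` — sixteen term bubbles, the direction trace keeps `(β,β′) = (ν,μ)`, each
product a square by evenness; the exact `ℤ⁴` twin of `SpinTable.bubble_spin_cell`. [folklore] -/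
theorem bub_spin_spin_cell {f : Fam} (hf : ∀ L k w, f L k (-w) = f L k w) {μ ν : Fin 4} (hμν : μ ≠ ν) (A A' : Matrix C C ℝ)
    (L k : ℕ) (v : Pt) :
    bub f f (spinStn μ A) (spinStn ν A') L k (v + unitVec μ) =
      -(2 * Matrix.trace (A * A') * mixedDiffFun (fun u => f L k u ^ 2) (unitVec μ) (unitVec ν) v) := by
  rw [bub_spinStn_left]
  simp only [bub_spinStn_right, bub_spinTerm_spinTerm, trace_spinMat_mul_spinMat_offdiag hμν, ite_mul, zero_mul]
  rw [sum_sum_ite_pair]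
  have h1 : f L k (-unitVec ν + unitVec μ - (v + unitVec μ)) = f L k (v + unitVec ν) := by
    rw [← hf L k (v + unitVec ν)]; congr 1; abel
  have h1' : f L k (v + unitVec μ - unitVec μ + unitVec ν) = f L k (v + unitVec ν) := by congr 1; abel
  have h2 : f L k (-unitVec ν - (v + unitVec μ)) = f L k (v + unitVec ν + unitVec μ) := by
    rw [← hf L k (v + unitVec ν + unitVec μ)]; congr 1; abel
  have h2' : f L k (v + unitVec μ + unitVec ν) = f L k (v + unitVec ν + unitVec μ) := by congr 1; abel
  have h3 : f L k (unitVec μ - (v + unitVec μ)) = f L k v := by rw [← hf L k v]; congr 1; abel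
  have h3' : f L k (v + unitVec μ - unitVec μ) = f L k v := by congr 1; abel
  rw [h1, h1', h2, h2', h3, h3', hf]
  simp only [mixedDiffFun]
  ring

end Spin

/-! ## §3 No cross table; the vector table on `ℤ⁴` -/

section Vec

variable {C : Type*} [Fintype C]

/-- a current term against a spin term vanishes: every elementary term carries `trace(copies A · spinMat) = 0`. [folklore] -/
theorem bub_current_spinTerm (f₁ f₂ : Fam) (μ ν β' : Fin 4) (A A' : Matrix C C ℝ) (L k : ℕ) (w : Pt) :
    bub f₁ f₂ (currentStn μ A) (spinTerm ν A' β') L k w = 0 := by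
  simp only [currentStn, spinTerm, jointDiff, rowDiff, colDiff, rowSh, colSh, smulS, pt, List.map_cons, List.map_nil,
    List.cons_append, List.nil_append, bub, bubRow, Pi.add_apply, term_mk, Matrix.smul_mul, Matrix.mul_smul, Matrix.trace_smul,
    smul_eq_mul, trace_copies_mul_spinMat, mul_zero, zero_mul, add_zero]

/-- a spin term against a current term vanishes. [folklore] -/
theorem bub_spinTerm_current (f₁ f₂ : Fam) (μ ν β : Fin 4) (A A' : Matrix C C ℝ) (L k : ℕ) (w : Pt) :
    bub f₁ f₂ (spinTerm μ A β) (currentStn ν A') L k w = 0 := by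
  simp only [currentStn, spinTerm, jointDiff, rowDiff, colDiff, rowSh, colSh, smulS, pt, List.map_cons, List.map_nil,
    List.cons_append, List.nil_append, bub, bubRow, Pi.add_apply, term_mk, Matrix.smul_mul, Matrix.mul_smul, Matrix.trace_smul,
    smul_eq_mul, trace_spinMat_mul_copies, mul_zero, zero_mul, add_zero]

/-- **NO CROSS TABLE** (current × spin), any legs — the `ℤ⁴` twin of `SpinTable.bubble_current_spin`. [folklore] -/
theorem bub_current_spin (f₁ f₂ : Fam) (μ ν : Fin 4) (A A' : Matrix C C ℝ) (L k : ℕ) (w : Pt) :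
    bub f₁ f₂ (currentStn μ A) (spinStn ν A') L k w = 0 := by
  simp only [bub_spinStn_right, bub_current_spinTerm, Finset.sum_const_zero]

/-- **NO CROSS TABLE** (spin × current), any legs — the `ℤ⁴` twin of `SpinTable.bubble_spin_current`. [folklore] -/
theorem bub_spin_current (f₁ f₂ : Fam) (μ ν : Fin 4) (A A' : Matrix C C ℝ) (L k : ℕ) (w : Pt) :
    bub f₁ f₂ (spinStn μ A) (currentStn ν A') L k w = 0 := by
  simp only [bub_spinStn_left, bub_spinTerm_current, Finset.sum_const_zero]

/-- **THE VECTOR TABLE ON `ℤ⁴`**: for an even leg, `μ ≠ ν` and any spin coupling `s`,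
`bub f f (vecStn s μ A) (vecStn s ν A′) L k (v + u_μ)`
`= 2·(4·trace(AA′))·cellForm (f L k) u_μ u_ν v − s²·(2·trace(AA′)·D_{u_μu_ν}((f L k)²)(v))` — the exact `ℤ⁴` twin of
`SpinTable.bubble_vec_cell` (`card D = 4`). [folklore] -/
theorem bub_vec_vec_cell {f : Fam} (hf : ∀ L k w, f L k (-w) = f L k w) {μ ν : Fin 4} (hμν : μ ≠ ν) (s : ℝ)
    (A A' : Matrix C C ℝ) (L k : ℕ) (v : Pt) :
    bub f f (vecStn s μ A) (vecStn s ν A') L k (v + unitVec μ) =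
      2 * (4 * Matrix.trace (A * A')) * cellForm (f L k) (unitVec μ) (unitVec ν) v
        - s ^ 2 * (2 * Matrix.trace (A * A') * mixedDiffFun (fun u => f L k u ^ 2) (unitVec μ) (unitVec ν) v) := by
  simp only [vecStn, bub_append_left, bub_append_right, bub_smul_left, bub_smul_right, Pi.add_apply, Pi.smul_apply, smul_eq_mul,
    bub_current_spin, bub_spin_current, bub_current_current_cell hf, bub_spin_spin_cell hf hμν]
  ring

/-- the vector table depends on the spin coupling through `s²` only: the Wilson action's DERIVED coupling `sTot = −2`
(`PlaquetteWeitzenbock.sTot`) and `SpinTable`'s labelled `s = 2` give THE SAME off-contact table. [folklore] -/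
theorem bub_vec_vec_sTot {f : Fam} (hf : ∀ L k w, f L k (-w) = f L k w) {μ ν : Fin 4} (hμν : μ ≠ ν) (A A' : Matrix C C ℝ)
    (L k : ℕ) (v : Pt) :
    bub f f (vecStn sTot μ A) (vecStn sTot ν A') L k (v + unitVec μ) = bub f f (vecStn 2 μ A) (vecStn 2 ν A') L k (v + unitVec μ) := by
  rw [bub_vec_vec_cell hf hμν, bub_vec_vec_cell hf hμν, sTot]
  norm_num

end Vec

/-! ## §4 Three sectors; the free-leg table is `SquareTable.lattBubble univ (bfCoeff N) bfP bfQ` by name -/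

section Three

variable {C : Type*} [Fintype C]

/-- **THREE SECTORS ON `ℤ⁴`**: `½·(vector bubble) − (ghost bubble) = trace(AA′)·((4 − 2)·cellForm − s²·D(f²))` — the exact
`ℤ⁴` twin of `SpinTable.three_sectors` at `card D = 4`. [folklore] -/
theorem three_sectors_Z4 {f : Fam} (hf : ∀ L k w, f L k (-w) = f L k w) {μ ν : Fin 4} (hμν : μ ≠ ν) (s : ℝ)
    (A A' : Matrix C C ℝ) (L k : ℕ) (v : Pt) :
    (1 / 2 : ℝ) * bub f f (vecStn s μ A) (vecStn s ν A') L k (v + unitVec μ)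
        - bub f f (ghostStn μ A) (ghostStn ν A') L k (v + unitVec μ) =
      Matrix.trace (A * A') *
        (((4 : ℝ) - 2) * cellForm (f L k) (unitVec μ) (unitVec ν) v
          - s ^ 2 * mixedDiffFun (fun u => f L k u ^ 2) (unitVec μ) (unitVec ν) v) := by
  rw [bub_vec_vec_cell hf hμν, bub_ghost_ghost_cell hf]
  ring

variable {N : ℕ} {Cc : Type*} [Fintype Cc] [DecidableEq Cc] {τ : Cc → Matrix (Fin N) (Fin N) ℂ}

/-- **THREE SECTORS, GENERAL `N`, AT `s² = 4`**: with `A = A′ = ad(τ_a)` for a complete tr-orthonormal Hermitian generator family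
(`GhostTable.trace_adMat_gen_sq`: `trace(A_aA_a) = −2N²`) the `ℤ⁴` three-sector table at `s = 2` is `SpinTable.bfKernel (f L k) N u_μ
u_ν v` — the exact `ℤ⁴` twin of `SpinTable.three_sectors_bf`. [folklore] -/
theorem three_sectors_bf_Z4 (hτ : Complete τ) (ho : TrOrthonormal τ) (hH : ∀ c, (τ c).IsHermitian) (hN : N ≠ 0)
    {f : Fam} (hf : ∀ L k w, f L k (-w) = f L k w) {μ ν : Fin 4} (hμν : μ ≠ ν) (L k : ℕ) (v : Pt) (a : Cc) :
    (1 / 2 : ℝ) * bub f f (vecStn 2 μ (adMat τ (τ a))) (vecStn 2 ν (adMat τ (τ a))) L k (v + unitVec μ)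
        - bub f f (ghostStn μ (adMat τ (τ a))) (ghostStn ν (adMat τ (τ a))) L k (v + unitVec μ) =
      bfKernel (f L k) N (unitVec μ) (unitVec ν) v := by
  rw [three_sectors_Z4 hf hμν, trace_adMat_gen_sq hτ ho hH hN, bfKernel_eq_model]

/-- the free legs are even (`latticeGreen_neg`). [folklore] -/
theorem free_even (L k : ℕ) (w : Pt) : free.g L k (-w) = free.g L k w := by
  rw [free_g_eq, free_g_eq, gFree, gFree, latticeGreen_neg]

/-- **THE FREE-LEG MODEL TABLE ON `ℤ⁴` IS `SquareTable`'S REALISED BACKGROUND-FIELD TABLE, BY NAME**: for `μ ≠ ν`, every scale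
`(L,k)`, every cell corner `v`, every complete tr-orthonormal Hermitian generator family and `N ≠ 0`,
`½·bub free.g free.g (vecStn 2 μ (ad τ_a)) (vecStn 2 ν (ad τ_a)) L k (v + u_μ)`
`− bub free.g free.g (ghostStn μ (ad τ_a)) (ghostStn ν (ad τ_a)) L k (v + u_μ) = lattBubble univ (bfCoeff N) (bfP hμν) (bfQ hμν) L k v`
(`SpinTable.lattBubble_bf_eq_bfKernel`).  This is the `ℤ⁴` vertex → table identification «which lattice vertex produces which
coefficient» for the model vector∕ghost sector at one loop. [folklore] -/
theorem model_table_free_eq_lattBubble_bf (hτ : Complete τ) (ho : TrOrthonormal τ) (hH : ∀ c, (τ c).IsHermitian) (hN : N ≠ 0)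
    {μ ν : Fin 4} (hμν : μ ≠ ν) (L k : ℕ) (v : Pt) (a : Cc) :
    (1 / 2 : ℝ) * bub free.g free.g (vecStn 2 μ (adMat τ (τ a))) (vecStn 2 ν (adMat τ (τ a))) L k (v + unitVec μ)
        - bub free.g free.g (ghostStn μ (adMat τ (τ a))) (ghostStn ν (adMat τ (τ a))) L k (v + unitVec μ) =
      lattBubble Finset.univ (bfCoeff N) (bfP hμν) (bfQ hμν) L k v := by
  rw [three_sectors_bf_Z4 hτ ho hH hN free_even hμν, lattBubble_bf_eq_bfKernel]
  rfl

/-- the same at the Wilson action's derived spin coupling `sTot = −2`. [folklore] -/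
theorem model_table_free_sTot_eq_lattBubble_bf (hτ : Complete τ) (ho : TrOrthonormal τ) (hH : ∀ c, (τ c).IsHermitian)
    (hN : N ≠ 0) {μ ν : Fin 4} (hμν : μ ≠ ν) (L k : ℕ) (v : Pt) (a : Cc) :
    (1 / 2 : ℝ) * bub free.g free.g (vecStn sTot μ (adMat τ (τ a))) (vecStn sTot ν (adMat τ (τ a))) L k (v + unitVec μ)
        - bub free.g free.g (ghostStn μ (adMat τ (τ a))) (ghostStn ν (adMat τ (τ a))) L k (v + unitVec μ) =
      lattBubble Finset.univ (bfCoeff N) (bfP hμν) (bfQ hμν) L k v := by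
  rw [bub_vec_vec_sTot free_even hμν, model_table_free_eq_lattBubble_bf hτ ho hH hN hμν]

end Three

/-! ## §5 Where this sits in the Wilson vertex: the main stencil's bubble splits into the vector block and three longitudinal blocks -/

section Main

variable {C : Type*} [Fintype C]

/-- **BILINEAR SPLIT OF THE MAIN BUBBLE**: `bub (mainStn γ A) (mainStn γ′ A′) = bub(vecStn sTot, vecStn sTot) + 2•bub(vecStn, divStn)
+ 2•bub(divStn, vecStn) + 4•bub(divStn, divStn)` — the first block is §3–§4; the longitudinal blocks are NOT evaluated in this file.
[folklore] -/
theorem bub_main_main_split (f₁ f₂ : Fam) (γ γ' : Fin 4) (A A' : Matrix C C ℝ) (L k : ℕ) (w : Pt) :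
    bub f₁ f₂ (mainStn γ A) (mainStn γ' A') L k w =
      bub f₁ f₂ (vecStn sTot γ A) (vecStn sTot γ' A') L k w + 2 * bub f₁ f₂ (vecStn sTot γ A) (divStn γ' A') L k w
        + 2 * bub f₁ f₂ (divStn γ A) (vecStn sTot γ' A') L k w + 4 * bub f₁ f₂ (divStn γ A) (divStn γ' A') L k w := by
  simp only [mainStn, bub_append_left, bub_append_right, bub_smul_left, bub_smul_right, Pi.add_apply, Pi.smul_apply, smul_eq_mul]
  ring

end Main

end Summit.QuantumFields.BalabanUV.Beta.VecTableZ4
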